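import Mathlib.Analysis.Complex.Schwarz
import Mathlib.Analysis.Complex.AbsMax
import Mathlib.Analysis.Calculus.DSlope
import Mathlib.Analysis.SpecialFunctions.Complex.Circle
import HarnessLib

/-!
# Typically real functions: Rogosinski's representation and the growth bound `|f(z) - z| ≤ 6|z|²`

A holomorphic `f` on the unit disc `𝔻` with `f(0) = 0`, `f'(0) = 1` is **typically real**
(Rogosinski 1932) if `Im f(z)` has the sign of `Im z`. The classical structure theorem
(W. Rogosinski, *Über positive harmonische Entwicklungen und typisch-reelle Potenzreihen*,
Math. Z. **35** (1932) 93–121; P. L. Duren, *Univalent Functions*, Springer (1983), §2.8,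
Thm. 2.20 "Rogosinski": `f` is typically real iff `f(z) = z p(z)/(1 - z²)` with `Re p > 0`,
`p(0) = 1`) is proved here in the direction we need, together with the resulting growth bound:

* `Literature.Analysis.Complex.norm_sub_one_le_of_re_nonneg` — **Carathéodory class growth**:
  `Re p ≥ 0` on `𝔻`, `p(0) = 1` ⇒ `|p(z) - 1| ≤ 2|z|/(1 - |z|)` (Schwarz's lemma for
  `P = (p - 1)/(p + 1) : 𝔻 → 𝔻̄`);
* `Literature.Analysis.Complex.IsTypicallyReal.re_rogosinski_nonneg` — **Rogosinski**: for `f`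
  typically real, `p(z) = (1 - z²) f(z)/z` (extended by `f'(0)` at `0`) has `Re p ≥ 0` (on
  `|z| = 1` one has `(1 - z²)/z = z̄ - z = -2i Im z`, so `Re p_ρ = 2 Im z · Im f(ρz)/ρ ≥ 0` for
  the dilations `f_ρ(z) = f(ρz)/ρ`, whence inside by the maximum modulus principle for
  `exp(-p_ρ)`, and `ρ → 1`);
* `Literature.Analysis.Complex.IsTypicallyReal.norm_sub_self_le` — **`|f(z) - z| ≤ 6|z|²` for
  `|z| ≤ 1/2`** when `f'(0) = 1`, and the rescaled form `|f(z) - a z| ≤ 6 a |z|²/R` on a disc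
  of radius `R` with `f'(0) = a > 0` (`norm_sub_le_of_ball`).

This is the function-theoretic core of the expansion of the map `g_A` of a small half-plane
hull at `∞` (G. F. Lawler, *Conformally Invariant Processes in the Plane* (2005), Prop. 3.46:
`|z - g_A(z) + hcap(A)/z| ≤ c rad(A) hcap(A)/|z|²`, there proved with Brownian motion): for a
hull `A ⊆ B̄(x₀, r)`, `w ↦ g_A(x₀ + 1/w) - x₀ - 1/w` is typically real on `|w| < 1/r` (up to
sign), `Im g_A ≤ Im`. Mathlib has Schwarz's lemma and the maximum modulus principle but no
typically real functions, Carathéodory class, or Rogosinski representation (searched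
`typically`, `Rogosinski`, `Caratheodory class`, `re_nonneg` growth).

## References

* W. Rogosinski, Math. Z. 35 (1932) 93–121; P. L. Duren, *Univalent Functions* (1983), §2.8.
* G. F. Lawler, *Conformally Invariant Processes in the Plane*, AMS (2005), Prop. 3.46
  [Lawler2005].
-/

noncomputable section

open Set Filter Metric
open _root_.Complex _root_.Topology

namespace Literature.Analysis.Complex

/-! ### The Carathéodory class: `Re p ≥ 0`, `p(0) = 1` -/

section Caratheodory

variable {p : ℂ → ℂ}

/-- `|p - 1| ≤ |p + 1|` when `Re p ≥ 0`. [folklore] -/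
theorem norm_sub_one_le_norm_add_one {w : ℂ} (hw : 0 ≤ w.re) : ‖w - 1‖ ≤ ‖w + 1‖ := by
  rw [← sq_le_sq₀ (norm_nonneg _) (norm_nonneg _), Complex.sq_norm, Complex.sq_norm,
    Complex.normSq_apply, Complex.normSq_apply]
  simp only [sub_re, one_re, sub_im, one_im, sub_zero, add_re, add_im, add_zero]
  nlinarith

/-- `p + 1 ≠ 0` when `Re p ≥ 0`. [folklore] -/
theorem add_one_ne_zero_of_re_nonneg {w : ℂ} (hw : 0 ≤ w.re) : w + 1 ≠ 0 := fun h ↦ by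
  have := congrArg Complex.re h
  simp at this
  linarith

/-- **Growth in the Carathéodory class**: if `p` is holomorphic on the unit disc with `p(0) = 1`
and `Re p ≥ 0`, then `|p(z) - 1| ≤ 2|z|/(1 - |z|)` (Schwarz's lemma for the self-map
`P = (p - 1)/(p + 1)` of the closed disc, `P(0) = 0`: `|P(z)| ≤ |z|`, and
`p - 1 = 2P/(1 - P)`). (Duren (1983) §2.8; Pommerenke, *Univalent Functions* (1975),
Lemma 2.1-type estimate.) [folklore] -/
theorem norm_sub_one_le_of_re_nonneg (hd : DifferentiableOn ℂ p (ball 0 1)) (h0 : p 0 = 1)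
    (hre : ∀ z ∈ ball (0 : ℂ) 1, 0 ≤ (p z).re) {z : ℂ} (hz : z ∈ ball (0 : ℂ) 1) :
    ‖p z - 1‖ ≤ 2 * ‖z‖ / (1 - ‖z‖) := by
  set P : ℂ → ℂ := fun w ↦ (p w - 1) / (p w + 1) with hP
  have hPd : DifferentiableOn ℂ P (ball 0 1) := (hd.sub_const 1).div (hd.add_const 1)
    fun w hw ↦ add_one_ne_zero_of_re_nonneg (hre w hw)
  have hP0 : P 0 = 0 := by simp [hP, h0]
  have hmaps : MapsTo P (ball 0 1) (closedBall (P 0) 1) := fun w hw ↦ by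
    rw [hP0, mem_closedBall_zero_iff, hP, norm_div]
    have h1 := norm_sub_one_le_norm_add_one (hre w hw)
    have h2 : 0 < ‖p w + 1‖ := norm_pos_iff.2 (add_one_ne_zero_of_re_nonneg (hre w hw))
    exact (div_le_one h2).2 h1
  have hPz : ‖P z‖ ≤ ‖z‖ := by
    have := Complex.dist_le_div_mul_dist_of_mapsTo_ball hPd hmaps hz
    simpa [hP0, div_one] using this
  have hz1 : ‖z‖ < 1 := mem_ball_zero_iff.1 hz
  have hPlt : ‖P z‖ < 1 := hPz.trans_lt hz1
  have hne : 1 - P z ≠ 0 := fun h ↦ by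
    have : ‖P z‖ = 1 := by rw [← sub_eq_zero.1 h, norm_one]
    linarith
  -- `p - 1 = 2P/(1 - P)`
  have hp1 : p z + 1 ≠ 0 := add_one_ne_zero_of_re_nonneg (hre z hz)
  have hid : p z - 1 = 2 * P z / (1 - P z) := by
    simp only [hP]
    field_simp
    ring
  rw [hid, norm_div, norm_mul, Complex.norm_two]
  have h3 : 1 - ‖z‖ ≤ ‖1 - P z‖ := by
    calc 1 - ‖z‖ ≤ 1 - ‖P z‖ := by linarith
      _ = ‖(1 : ℂ)‖ - ‖P z‖ := by rw [norm_one]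
      _ ≤ ‖1 - P z‖ := norm_sub_norm_le _ _
  have h4 : 0 < 1 - ‖z‖ := by linarith
  calc 2 * ‖P z‖ / ‖1 - P z‖ ≤ 2 * ‖z‖ / ‖1 - P z‖ := by gcongr
    _ ≤ 2 * ‖z‖ / (1 - ‖z‖) := div_le_div_of_nonneg_left (by positivity) h4 h3

end Caratheodory

/-! ### Typically real functions and Rogosinski's representation -/

/-- **Typically real function** on the unit disc (Rogosinski 1932; Duren (1983) §2.8): `f` is
holomorphic on `𝔻`, `f(0) = 0`, and `Im f(z)` has the (weak) sign of `Im z`: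
`Im z ≥ 0 ⇒ Im f(z) ≥ 0` and `Im z ≤ 0 ⇒ Im f(z) ≤ 0`. (The classical definition asks `f` real
exactly on the real diameter; the weak sign condition is what the maps of half-plane hulls
satisfy and all that the estimates need.) [folklore] -/
structure IsTypicallyReal (f : ℂ → ℂ) : Prop where
  differentiableOn : DifferentiableOn ℂ f (ball 0 1)
  map_zero : f 0 = 0
  im_nonneg : ∀ z ∈ ball (0 : ℂ) 1, 0 ≤ z.im → 0 ≤ (f z).im
  im_nonpos : ∀ z ∈ ball (0 : ℂ) 1, z.im ≤ 0 → (f z).im ≤ 0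

namespace IsTypicallyReal

variable {f : ℂ → ℂ}

/-- `Im z · Im f(z) ≥ 0`. [folklore] -/
theorem im_mul_im_nonneg (hf : IsTypicallyReal f) {z : ℂ} (hz : z ∈ ball (0 : ℂ) 1) :
    0 ≤ z.im * (f z).im := by
  rcases le_total 0 z.im with h | h
  · exact mul_nonneg h (hf.im_nonneg z hz h)
  · exact mul_nonneg_of_nonpos_of_nonpos h (hf.im_nonpos z hz h)

/-- **The dilations `f_ρ(z) = f(ρz)/ρ`** (`0 < ρ < 1`) are typically real and holomorphic on the
larger disc `|z| < 1/ρ`. [folklore] -/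
theorem dilation (hf : IsTypicallyReal f) {ρ : ℝ} (hρ0 : 0 < ρ) (hρ1 : ρ < 1) :
    IsTypicallyReal (fun z ↦ (ρ : ℂ)⁻¹ * f (ρ * z)) where
  differentiableOn := by
    refine (differentiableOn_const _).mul (hf.differentiableOn.comp
      ((differentiableOn_const _).mul differentiableOn_id) fun z hz ↦ ?_)
    rw [mem_ball_zero_iff] at hz ⊢
    rw [norm_mul, Complex.norm_real, Real.norm_of_nonneg hρ0.le]
    nlinarith [norm_nonneg z]
  map_zero := by simp [hf.map_zero]
  im_nonneg := fun z hz hzi ↦ by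
    have hρz : (ρ : ℂ) * z ∈ ball (0 : ℂ) 1 := by
      rw [mem_ball_zero_iff] at hz ⊢
      rw [norm_mul, Complex.norm_real, Real.norm_of_nonneg hρ0.le]; nlinarith [norm_nonneg z]
    have h1 : 0 ≤ (f (ρ * z)).im := hf.im_nonneg _ hρz (by simpa using mul_nonneg hρ0.le hzi)
    rw [← Complex.ofReal_inv, Complex.im_ofReal_mul]
    exact mul_nonneg (inv_nonneg.2 hρ0.le) h1
  im_nonpos := fun z hz hzi ↦ by
    have hρz : (ρ : ℂ) * z ∈ ball (0 : ℂ) 1 := by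
      rw [mem_ball_zero_iff] at hz ⊢
      rw [norm_mul, Complex.norm_real, Real.norm_of_nonneg hρ0.le]; nlinarith [norm_nonneg z]
    have h1 : (f (ρ * z)).im ≤ 0 :=
      hf.im_nonpos _ hρz (by simpa using mul_nonpos_of_nonneg_of_nonpos hρ0.le hzi)
    rw [← Complex.ofReal_inv, Complex.im_ofReal_mul]
    exact mul_nonpos_of_nonneg_of_nonpos (inv_nonneg.2 hρ0.le) h1

/-- **Rogosinski's function** `p(z) = (1 - z²) f(z)/z`, extended by `f'(0)` at `z = 0`, as
`(1 - z²) · dslope f 0 z`. [folklore] -/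
def rogosinski (f : ℂ → ℂ) (z : ℂ) : ℂ := (1 - z ^ 2) * dslope f 0 z

/-- `p(z) = (1 - z²) f(z)/z` for `z ≠ 0` (`f(0) = 0`). [folklore] -/
theorem rogosinski_of_ne (hf : IsTypicallyReal f) {z : ℂ} (hz : z ≠ 0) :
    rogosinski f z = (1 - z ^ 2) * f z / z := by
  rw [rogosinski, dslope_of_ne _ hz, slope, hf.map_zero, sub_zero, vsub_eq_sub, sub_zero,
    smul_eq_mul, mul_div_assoc, div_eq_inv_mul]

/-- `p(0) = f'(0)`. [folklore] -/
theorem rogosinski_zero (f : ℂ → ℂ) : rogosinski f 0 = deriv f 0 := by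
  simp [rogosinski, dslope_same]

/-- `p` is holomorphic on the disc. [folklore] -/
theorem differentiableOn_rogosinski (hf : IsTypicallyReal f) :
    DifferentiableOn ℂ (rogosinski f) (ball 0 1) := by
  have h1 : DifferentiableOn ℂ (dslope f 0) (ball 0 1) := by
    intro z hz
    rcases eq_or_ne z 0 with rfl | hne
    · -- at the centre: `dslope f 0` has a power series there since `f` has
      have han : AnalyticAt ℂ f 0 :=
        hf.differentiableOn.analyticAt (ball_mem_nhds 0 one_pos)
      obtain ⟨q, hq⟩ := han
      exact (hq.has_fpower_series_dslope_fslope.analyticAt).differentiableAt.differentiableWithinAt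
    · exact ((differentiableAt_dslope_of_ne hne).2
        (hf.differentiableOn.differentiableAt (isOpen_ball.mem_nhds hz))).differentiableWithinAt
  exact ((differentiableOn_const 1).sub (differentiableOn_id.pow 2)).mul h1

/-- **On the unit circle `(1 - z²)/z = -2i Im z`**, so `Re ((1 - z²) w / z) = 2 Im z · Im w`.
[folklore] -/
theorem re_one_sub_sq_mul_div {z : ℂ} (hz : ‖z‖ = 1) (w : ℂ) :
    ((1 - z ^ 2) * w / z).re = 2 * z.im * w.im := by
  have hz0 : z ≠ 0 := by rintro rfl; simp at hz
  have hzz : z * (starRingEnd ℂ) z = 1 := by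
    rw [Complex.mul_conj, Complex.normSq_eq_norm_sq, hz]; simp
  have hinv : z⁻¹ = (starRingEnd ℂ) z := inv_eq_of_mul_eq_one_right hzz
  have hz2 : z ^ 2 * (starRingEnd ℂ) z = z := by rw [sq, mul_assoc, hzz, mul_one]
  have : (1 - z ^ 2) * w / z = ((starRingEnd ℂ) z - z) * w := by
    rw [div_eq_mul_inv, hinv]; linear_combination (-w) * hz2
  rw [this, Complex.mul_re, Complex.sub_re, Complex.sub_im, Complex.conj_re, Complex.conj_im]
  ring

/-- **Rogosinski's theorem** (the direction "typically real ⇒ Carathéodory"): for a typically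
real `f`, `Re ((1 - z²) f(z)/z) ≥ 0` on the disc. Proof: for `0 < ρ < 1` the dilation `f_ρ`
is holomorphic across the unit circle, where `Re p_ρ = 2 Im z · Im f_ρ(z) ≥ 0`; the maximum
modulus principle for `exp(-p_ρ)` on the disc gives `Re p_ρ ≥ 0` inside, and
`p_ρ(z) → p(z)` as `ρ → 1`. (Rogosinski (1932); Duren (1983), Thm. 2.20.) [folklore] -/
theorem re_rogosinski_nonneg (hf : IsTypicallyReal f) {z : ℂ} (hz : z ∈ ball (0 : ℂ) 1) :
    0 ≤ (rogosinski f z).re := by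
  rcases eq_or_ne z 0 with rfl | hz0
  · -- `p(0) = f'(0) ≥ 0`: `f'(0) = lim f(t)/t` over real `t ↓ 0`, real part `≥`... use `ρ`-limit below
    -- instead: `p(0)` is the limit of `p(t)` for real `t → 0`, and `Re p(t) ≥ 0` for `t ≠ 0`
    have hcont : ContinuousAt (rogosinski f) 0 :=
      (hf.differentiableOn_rogosinski.differentiableAt (ball_mem_nhds 0 one_pos)).continuousAt
    have hre : Tendsto (fun w ↦ (rogosinski f w).re) (𝓝[≠] 0) (𝓝 (rogosinski f 0).re) :=
      ((Complex.continuous_re.tendsto _).comp hcont.tendsto).mono_left nhdsWithin_le_nhds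
    haveI : (𝓝[≠] (0 : ℂ)).NeBot := NormedField.nhdsNE_neBot 0
    refine ge_of_tendsto hre ?_
    filter_upwards [mem_nhdsWithin_of_mem_nhds (ball_mem_nhds (0 : ℂ) one_pos),
      self_mem_nhdsWithin] with w hw hw'
    exact this_aux hf hw hw'
  · exact this_aux hf hz hz0
where
  /-- the case `z ≠ 0` -/
  this_aux {f : ℂ → ℂ} (hf : IsTypicallyReal f) {z : ℂ} (hz : z ∈ ball (0 : ℂ) 1) (hz0 : z ≠ 0) :
      0 ≤ (rogosinski f z).re := by
    rw [hf.rogosinski_of_ne hz0]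
    have hz1 : ‖z‖ < 1 := mem_ball_zero_iff.1 hz
    -- the dilations
    have key : ∀ ρ : ℝ, ‖z‖ < ρ → ρ < 1 → 0 ≤ ((1 - z ^ 2) * ((ρ : ℂ)⁻¹ * f (ρ * z)) / z).re := by
      intro ρ hzρ hρ1
      have hρ0 : 0 < ρ := (norm_nonneg z).trans_lt hzρ
      have hfρ := hf.dilation hρ0 hρ1
      -- `q = exp (-p_ρ)` is holomorphic on a neighbourhood of the closed unit disc
      set g : ℂ → ℂ := fun w ↦ (ρ : ℂ)⁻¹ * f (ρ * w) with hg
      have hgd : DifferentiableOn ℂ g (ball 0 ρ⁻¹) := by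
        refine (differentiableOn_const _).mul (hf.differentiableOn.comp
          ((differentiableOn_const _).mul differentiableOn_id) fun w hw ↦ ?_)
        rw [mem_ball_zero_iff] at hw ⊢
        rw [norm_mul, Complex.norm_real, Real.norm_of_nonneg hρ0.le]
        calc ρ * ‖w‖ < ρ * ρ⁻¹ := mul_lt_mul_of_pos_left hw hρ0
          _ = 1 := mul_inv_cancel₀ hρ0.ne'
      have h1ρ : (1 : ℝ) < ρ⁻¹ := one_lt_inv₀ hρ0 |>.2 hρ1
      have hball : closedBall (0 : ℂ) 1 ⊆ ball 0 ρ⁻¹ := closedBall_subset_ball h1ρ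
      set P : ℂ → ℂ := fun w ↦ (1 - w ^ 2) * dslope g 0 w with hP
      have hPd : DifferentiableOn ℂ P (ball 0 ρ⁻¹) := by
        have h1 : DifferentiableOn ℂ (dslope g 0) (ball 0 ρ⁻¹) := by
          intro w hw
          rcases eq_or_ne w 0 with rfl | hne
          · have han : AnalyticAt ℂ g 0 := hgd.analyticAt (ball_mem_nhds 0 (by positivity))
            obtain ⟨q, hq⟩ := han
            exact (hq.has_fpower_series_dslope_fslope.analyticAt).differentiableAt.differentiableWithinAt
          · exact ((differentiableAt_dslope_of_ne hne).2
              (hgd.differentiableAt (isOpen_ball.mem_nhds hw))).differentiableWithinAt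
        exact ((differentiableOn_const 1).sub (differentiableOn_id.pow 2)).mul h1
      have hPeq : ∀ w, w ≠ 0 → P w = (1 - w ^ 2) * g w / w := fun w hw ↦ by
        simp only [hP]
        rw [dslope_of_ne _ hw, slope, hfρ.map_zero, sub_zero, vsub_eq_sub, sub_zero, smul_eq_mul,
          mul_div_assoc, div_eq_inv_mul]
      -- maximum modulus for `exp (-P)` on the unit disc
      have hqd : DiffContOnCl ℂ (fun w ↦ Complex.exp (-P w)) (ball 0 1) := by
        refine DifferentiableOn.diffContOnCl ?_
        rw [closure_ball 0 one_ne_zero]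
        exact (hPd.mono hball).neg.cexp
      have hfront : ∀ w ∈ frontier (ball (0 : ℂ) 1), ‖Complex.exp (-P w)‖ ≤ 1 := by
        intro w hw
        rw [frontier_ball 0 one_ne_zero, mem_sphere_zero_iff_norm] at hw
        have hw0 : w ≠ 0 := by rintro rfl; simp at hw
        rw [Complex.norm_exp, Real.exp_le_one_iff, Complex.neg_re, neg_nonpos, hPeq w hw0,
          re_one_sub_sq_mul_div hw]
        have hwb : w ∈ ball (0 : ℂ) 1 ∨ True := Or.inr trivial
        -- `Im w · Im g w ≥ 0` (typical realness of the dilation, valid on the closed disc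
        -- through the sign conditions at `|w| = 1` via continuity? no: use `ρ w ∈ 𝔻` directly)
        have hρw : (ρ : ℂ) * w ∈ ball (0 : ℂ) 1 := by
          rw [mem_ball_zero_iff, norm_mul, Complex.norm_real, Real.norm_of_nonneg hρ0.le, hw, mul_one]
          exact hρ1
        have hsign : 0 ≤ w.im * (g w).im := by
          simp only [hg]
          rw [← Complex.ofReal_inv, Complex.im_ofReal_mul]
          rcases le_total 0 w.im with h | h
          · have := hf.im_nonneg _ hρw (by simpa using mul_nonneg hρ0.le h)
            exact mul_nonneg h (mul_nonneg (inv_nonneg.2 hρ0.le) this)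
          · have := hf.im_nonpos _ hρw (by simpa using mul_nonpos_of_nonneg_of_nonpos hρ0.le h)
            exact mul_nonneg_of_nonpos_of_nonpos h
              (mul_nonpos_of_nonneg_of_nonpos (inv_nonneg.2 hρ0.le) this)
        linarith
      have hin := Complex.norm_le_of_forall_mem_frontier_norm_le isBounded_ball hqd hfront
        (subset_closure hz)
      rw [Complex.norm_exp, Real.exp_le_one_iff, Complex.neg_re, neg_nonpos, hPeq z hz0] at hin
      simpa only [hg] using hin
    -- pass to the limit `ρ → 1`
    have hlim : Tendsto (fun ρ : ℝ ↦ ((1 - z ^ 2) * ((ρ : ℂ)⁻¹ * f (ρ * z)) / z).re)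
        (𝓝[<] 1) (𝓝 (((1 - z ^ 2) * f z / z).re)) := by
      have hfc : ContinuousAt f z := (hf.differentiableOn.differentiableAt (isOpen_ball.mem_nhds hz)).continuousAt
      have h1 : Tendsto (fun ρ : ℝ ↦ (ρ : ℂ) * z) (𝓝 1) (𝓝 z) := by
        have : Continuous fun ρ : ℝ ↦ (ρ : ℂ) * z := by fun_prop
        simpa using this.tendsto 1
      have h2 : Tendsto (fun ρ : ℝ ↦ f (ρ * z)) (𝓝 1) (𝓝 (f z)) := hfc.tendsto.comp h1
      have h3 : Tendsto (fun ρ : ℝ ↦ (ρ : ℂ)⁻¹) (𝓝 1) (𝓝 1) := by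
        have : Tendsto (fun ρ : ℝ ↦ (ρ : ℂ)) (𝓝 1) (𝓝 ((1 : ℝ) : ℂ)) := Complex.continuous_ofReal.tendsto 1
        simpa using this.inv₀ (by simp)
      have h4 := ((h3.mul h2).const_mul (1 - z ^ 2)).div_const z
      simp only [one_mul] at h4
      exact ((Complex.continuous_re.tendsto _).comp h4).mono_left nhdsWithin_le_nhds
    refine ge_of_tendsto hlim ?_
    filter_upwards [mem_nhdsWithin_of_mem_nhds (lt_mem_nhds hz1), self_mem_nhdsWithin]
      with ρ hρ hρ' using key ρ hρ hρ'

/-- **Growth of a typically real function**: if moreover `f'(0) = 1`, then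
`|f(z) - z| ≤ 6|z|²` for `|z| ≤ 1/2` (`f = z p/(1 - z²)` with `|p - 1| ≤ 2|z|/(1 - |z|)`).
[folklore] -/
theorem norm_sub_self_le (hf : IsTypicallyReal f) (hf1 : deriv f 0 = 1) {z : ℂ}
    (hz : ‖z‖ ≤ 1 / 2) : ‖f z - z‖ ≤ 6 * ‖z‖ ^ 2 := by
  rcases eq_or_ne z 0 with rfl | hz0
  · simp [hf.map_zero]
  have hzb : z ∈ ball (0 : ℂ) 1 := mem_ball_zero_iff.2 (by linarith)
  have hp0 : rogosinski f 0 = 1 := by rw [rogosinski_zero, hf1]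
  have hp := norm_sub_one_le_of_re_nonneg hf.differentiableOn_rogosinski hp0
    (fun w hw ↦ hf.re_rogosinski_nonneg hw) hzb
  -- `f z = z p z/(1 - z²)`
  have h1z : 1 - z ^ 2 ≠ 0 := by
    intro h
    have : ‖z‖ ^ 2 = 1 := by
      have := congrArg norm (sub_eq_zero.1 h)
      rw [norm_one, norm_pow] at this; exact this.symm
    nlinarith [norm_nonneg z]
  have hf_eq : f z = z * rogosinski f z / (1 - z ^ 2) := by
    rw [hf.rogosinski_of_ne hz0]; field_simp
  have hid : f z - z = z * ((rogosinski f z - 1) + z ^ 2) / (1 - z ^ 2) := by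
    rw [hf_eq]; field_simp; ring
  rw [hid, norm_div, norm_mul]
  have hn1 : 1 - ‖z‖ ^ 2 ≤ ‖1 - z ^ 2‖ := by
    calc 1 - ‖z‖ ^ 2 = ‖(1 : ℂ)‖ - ‖z ^ 2‖ := by rw [norm_one, norm_pow]
      _ ≤ ‖1 - z ^ 2‖ := norm_sub_norm_le _ _
  have hz2 : ‖z‖ ^ 2 ≤ 1 / 4 := by nlinarith [norm_nonneg z]
  have hpos : (0 : ℝ) < 1 - ‖z‖ ^ 2 := by linarith
  have hnum : ‖(rogosinski f z - 1) + z ^ 2‖ ≤ 9 / 2 * ‖z‖ := by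
    calc ‖(rogosinski f z - 1) + z ^ 2‖ ≤ ‖rogosinski f z - 1‖ + ‖z ^ 2‖ := norm_add_le _ _
      _ ≤ 2 * ‖z‖ / (1 - ‖z‖) + ‖z‖ ^ 2 := by rw [norm_pow]; exact add_le_add hp le_rfl
      _ ≤ 4 * ‖z‖ + ‖z‖ / 2 := by
          have h1 : 2 * ‖z‖ / (1 - ‖z‖) ≤ 4 * ‖z‖ := by
            rw [div_le_iff₀ (by linarith)]; nlinarith [norm_nonneg z]
          have h2 : ‖z‖ ^ 2 ≤ ‖z‖ / 2 := by nlinarith [norm_nonneg z]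
          linarith
      _ = 9 / 2 * ‖z‖ := by ring
  calc ‖z‖ * ‖(rogosinski f z - 1) + z ^ 2‖ / ‖1 - z ^ 2‖
      ≤ ‖z‖ * (9 / 2 * ‖z‖) / (1 - ‖z‖ ^ 2) := by
        refine div_le_div₀ (by positivity) (by gcongr) hpos hn1
    _ ≤ ‖z‖ * (9 / 2 * ‖z‖) / (3 / 4) := by
        refine div_le_div_of_nonneg_left (by positivity) (by norm_num) (by linarith)
    _ = 6 * ‖z‖ ^ 2 := by ring

end IsTypicallyReal

/-- **Rescaled growth bound**: `f` holomorphic on `B(0, R)`, `f(0) = 0`, `f'(0) = a > 0`, with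
`Im z · Im f(z) ≥ 0` (weakly), satisfies `|f(z) - a z| ≤ 6 a |z|²/R` for `|z| ≤ R/2` (apply
`IsTypicallyReal.norm_sub_self_le` to `z ↦ f(Rz)/(aR)`). [folklore] -/
theorem norm_sub_le_of_ball {f : ℂ → ℂ} {R a : ℝ} (hR : 0 < R) (ha : 0 < a)
    (hd : DifferentiableOn ℂ f (ball 0 R)) (h0 : f 0 = 0) (hderiv : deriv f 0 = a)
    (hpos : ∀ z ∈ ball (0 : ℂ) R, 0 ≤ z.im → 0 ≤ (f z).im)
    (hneg : ∀ z ∈ ball (0 : ℂ) R, z.im ≤ 0 → (f z).im ≤ 0) {z : ℂ} (hz : ‖z‖ ≤ R / 2) :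
    ‖f z - a * z‖ ≤ 6 * a * ‖z‖ ^ 2 / R := by
  set F : ℂ → ℂ := fun w ↦ ((a * R : ℝ) : ℂ)⁻¹ * f (R * w) with hF
  have hmem : ∀ w ∈ ball (0 : ℂ) 1, (R : ℂ) * w ∈ ball (0 : ℂ) R := fun w hw ↦ by
    rw [mem_ball_zero_iff] at hw ⊢
    rw [norm_mul, Complex.norm_real, Real.norm_of_nonneg hR.le]
    calc R * ‖w‖ < R * 1 := mul_lt_mul_of_pos_left hw hR
      _ = R := mul_one R
  have haR : (0 : ℝ) < a * R := mul_pos ha hR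
  have hFt : IsTypicallyReal F :=
    { differentiableOn := (differentiableOn_const _).mul
        (hd.comp ((differentiableOn_const _).mul differentiableOn_id) hmem)
      map_zero := by simp [hF, h0]
      im_nonneg := fun w hw hwi ↦ by
        simp only [hF]
        rw [← Complex.ofReal_inv, Complex.im_ofReal_mul]
        exact mul_nonneg (inv_nonneg.2 haR.le) (hpos _ (hmem w hw) (by simpa using mul_nonneg hR.le hwi))
      im_nonpos := fun w hw hwi ↦ by
        simp only [hF]
        rw [← Complex.ofReal_inv, Complex.im_ofReal_mul]
        exact mul_nonpos_of_nonneg_of_nonpos (inv_nonneg.2 haR.le)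
          (hneg _ (hmem w hw) (by simpa using mul_nonpos_of_nonneg_of_nonpos hR.le hwi)) }
  have ha' : (a : ℂ) ≠ 0 := by exact_mod_cast ha.ne'
  have hR' : (R : ℂ) ≠ 0 := by exact_mod_cast hR.ne'
  have hF1 : deriv F 0 = 1 := by
    have h1 : HasDerivAt (fun w : ℂ ↦ (R : ℂ) * w) (R : ℂ) 0 := by
      simpa using (hasDerivAt_id (0 : ℂ)).const_mul (R : ℂ)
    have hf0 : HasDerivAt f (a : ℂ) ((fun w : ℂ ↦ (R : ℂ) * w) 0) := by
      have hdiff : DifferentiableAt ℂ f 0 := hd.differentiableAt (ball_mem_nhds 0 hR)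
      have := hdiff.hasDerivAt
      rw [hderiv] at this
      simpa using this
    have h2 : HasDerivAt (fun w : ℂ ↦ f ((R : ℂ) * w)) ((a : ℂ) * R) 0 := hf0.comp 0 h1
    have h3 := h2.const_mul (((a * R : ℝ) : ℂ)⁻¹)
    have h4 : deriv F 0 = ((a * R : ℝ) : ℂ)⁻¹ * ((a : ℂ) * R) := h3.deriv
    rw [h4]
    push_cast
    field_simp
  -- apply the unit-disc bound at `w = z/R`
  have hw : ‖z / R‖ ≤ 1 / 2 := by
    rw [norm_div, Complex.norm_real, Real.norm_of_nonneg hR.le, div_le_iff₀ hR]; linarith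
  have key := hFt.norm_sub_self_le hF1 hw
  have hRz : (R : ℂ) * (z / R) = z := mul_div_cancel₀ z hR'
  simp only [hF, hRz] at key
  -- `F(z/R) - z/R = (f z - a z)/(aR)`
  have hid : ((a * R : ℝ) : ℂ)⁻¹ * f z - z / R = ((a * R : ℝ) : ℂ)⁻¹ * (f z - a * z) := by
    push_cast; field_simp
  rw [hid, norm_mul, norm_inv, Complex.norm_real, Real.norm_of_nonneg haR.le, norm_div,
    Complex.norm_real, Real.norm_of_nonneg hR.le, inv_mul_le_iff₀ haR] at key
  calc ‖f z - a * z‖ ≤ a * R * (6 * (‖z‖ / R) ^ 2) := key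
    _ = 6 * a * ‖z‖ ^ 2 / R := by field_simp

end Literature.Analysis.Complex

end
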